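import Summits.QuantumFields.YangMills.Theorems.BalabanUVNodesN21LowCentreNumeral
import Literature.MathematicalPhysics.QuantumFieldTheory.Balaban1983to89.B16Sect1Wilson

/-!
# N21 (NE7c) · THE LOCATED NUMERAL IN THE BLOCK CHART OF [LF-II] §1: ℓ² ↔ sup transfer, the VALUE-DEFECT certificate,
# and the clause at the (1.2) ∕ (1.6) ∕ (1.9) letters BY NAME (plan g77 W-SEAT-START-LIST §n21 item 1, third part)

Width seat pub-ymgap-dag-n21-w1 (g0; director-ym №197 ∕ HUMAN RULING D-0149), node N21 = NE7c (single-run shell-weight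
bound, NOT PRINTED in [Bałaban 1983–89], NOT proved), lane K3⁷ `SpineGivenEndpointR13SepCoPH` (stmt-QuantumFields-20544,
`--kind proof --supports … --as helper`).  Sequel of `…N21LowCentreNumeral` (p583903).  Consumes BY NAME n21-d part 31
`slotAntiConcentration_restrict_of_lowCentre`, part 30 `norm_sub_ge_of_reading`, and the PRINTED rows of
[Balaban1989LargeFieldII] §1 in the tree: `B16Sect1Wilson.Ineq16` ((1.6)) and `Ineq19` ((1.9)).

WHY.  p583903 reduced the dilation road's located numeral `2G∕γ ≤ l₀(θ(1−ρ)−c₀)∕L` to one letter ratio, with `G` =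
gradient residual of the non-quadratic block action and `γ` = its coercivity — LOCATED at the desk's ROW Q′ as
«parametric in print».  The desk's ME #33∕#34 (l.24604∕l.24605, [LF-II] pp.356–358 AS PRINTED) gives print's letters at
the 𝐑-operation's block `Λ ⊂` cube `100M`: the exponent of (1.2) in the chart `V′ = exp ig_kB′`, `|B′| < M₀g_k⁻¹ε_k`, is
`−½⟨H_{1,k}B′, Δ₁(ζ₀)H_{1,k}B′⟩ − (1∕g_k)⟨DH_{1,k}B′, ζ₀η⁻²Im ∂U₀⟩ − (1∕g_k²)V(ζ₀, g_kH_{1,k}B′)`; the quadratic member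
is coercive in ℓ²(Λ): (1.9) `≥ γ₀∕(2d(100M)⁵)‖B′‖²` «for g_k sufficiently small»; the linear member is bounded BY VALUE:
(1.6) `< 3B₃M₀A₀²p₀²(g_k)e^{−R_k}(100M)⁴` «e.g., the number 1»; the remainder BY VALUE: «O(g_k^{1−β})|Λ|» (prose).
So print supplies (i) an ℓ² coercivity, (ii) VALUE bounds, not gradient bounds.  This file adapts the certificate:
§1 ℓ² ↔ sup transfer on the block chart `κ → ℝ` (`‖w‖² ≤ Σ_b w_b² ≤ #κ‖w‖²`; an ℓ² model with `(G, γ)` is a sup model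
with `(G√#κ, γ)`); §2 the VALUE-DEFECT certificate (`φ ≥ φ(m) − G‖·‖ − W + (γ∕2)‖·‖²` ⇒ the centre is low beyond
`2G∕γ + √(2W∕γ)`; numeral `2G∕γ + √(2W∕γ) ≤ l₀(θ(1−ρ)−c₀)∕L`); §3 ★ part 31's END with `hlow` discharged by it; §4 its A6
witness (genuine defect `W = 1∕576`, `G = 0`); §5 ★★ the defect model about the background FROM the (1.2)∕(1.6)∕(1.9)
letters BY NAME (`Ineq16`, `Ineq19` as hypotheses on the chart) with `G = 0`, `W = (1.6) + W_V`, `γ = γ₀∕(2d(100M)^{d+1})`,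
and ★★★ the numeral there from ONE clause `16·W·d·(100M)^{d+1}·L² ≤ γ₀·(θ(1−ρ−σ))²` — print's «for g_k sufficiently
small» (in the rescaled chart the letter `θ∕L` carries `ε_k∕g_k = A₀p₀(g_k) → ∞`, while `W` stays `≤ 1 + O(g_k^{1−β})|Λ|`).

HONEST FRAMING.  [textbook] normed-space ∕ real arithmetic + by-name citation of PROVED∕typed B16 rows; 0 def, 0 sorry;
the identification of the model's letters with (1.2)∕(1.6)∕(1.9) is THIS SEAT's typing over displayed hypotheses —
nothing of Bałaban's asserted, every located letter a hypothesis; NE7c NOT PRINTED ∕ NOT proved; N21 NOT discharged;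
counts unmoved (typed 28∕28 · discharged 5∕27); count-neutral; one finite 𝕋⁴ at fixed ε — R4 would close only the
conditional finite-𝕋⁴ rung `BalabanLadder.UV`, NOT the Yang–Mills mass gap (Clay); nothing about ℝ⁴ ∕ OS.
-/

set_option autoImplicit false

open Finset

namespace Summit.QuantumFields.YangMills.Theorems.N21LowCentreNumeralBlock

section NormTransfer

variable {κ : Type*} [Fintype κ]

/-- on the block chart `κ → ℝ` the sup norm is at most the Euclidean one: `‖w‖ ≤ √(Σ_b w_b²)`. [textbook] -/
theorem pi_norm_le_sqrt_sum_sq (w : κ → ℝ) : ‖w‖ ≤ Real.sqrt (∑ b, w b ^ 2) := by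
  refine (pi_norm_le_iff_of_nonneg (Real.sqrt_nonneg _)).2 fun b => ?_
  rw [Real.norm_eq_abs, ← Real.sqrt_sq_eq_abs]
  exact Real.sqrt_le_sqrt (single_le_sum (f := fun b => w b ^ 2) (fun i _ => sq_nonneg (w i)) (mem_univ b))

/-- `‖w‖² ≤ Σ_b w_b²`. [textbook] -/
theorem sq_pi_norm_le_sum_sq (w : κ → ℝ) : ‖w‖ ^ 2 ≤ ∑ b, w b ^ 2 := by
  have h := pi_norm_le_sqrt_sum_sq w
  have h0 : 0 ≤ ∑ b, w b ^ 2 := sum_nonneg fun b _ => sq_nonneg (w b)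
  calc ‖w‖ ^ 2 ≤ Real.sqrt (∑ b, w b ^ 2) ^ 2 := by gcongr
    _ = ∑ b, w b ^ 2 := Real.sq_sqrt h0

/-- `Σ_b w_b² ≤ #κ·‖w‖²`. [textbook] -/
theorem sum_sq_le_card_mul_sq_pi_norm (w : κ → ℝ) : ∑ b, w b ^ 2 ≤ (Fintype.card κ : ℝ) * ‖w‖ ^ 2 := by
  calc ∑ b, w b ^ 2 ≤ ∑ _b : κ, ‖w‖ ^ 2 := sum_le_sum fun b _ => by
        have h := norm_le_pi_norm w b
        rw [Real.norm_eq_abs] at h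
        rw [← sq_abs]
        gcongr
    _ = (Fintype.card κ : ℝ) * ‖w‖ ^ 2 := by rw [sum_const, card_univ, nsmul_eq_mul]

/-- `√(Σ_b w_b²) ≤ √#κ · ‖w‖`. [textbook] -/
theorem sqrt_sum_sq_le_sqrt_card_mul_pi_norm (w : κ → ℝ) :
    Real.sqrt (∑ b, w b ^ 2) ≤ Real.sqrt (Fintype.card κ : ℝ) * ‖w‖ := by
  rw [← Real.sqrt_sq (norm_nonneg w), ← Real.sqrt_mul (Nat.cast_nonneg _)]
  exact Real.sqrt_le_sqrt (sum_sq_le_card_mul_sq_pi_norm w)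

/-- **ℓ² FIRST-ORDER MODEL ⇒ SUP-NORM FIRST-ORDER MODEL.**  If the block potential dominates the Euclidean model
`φ m − G√(Σ_b (v−m)_b²) + (γ∕2)Σ_b (v−m)_b²` on `K` (print's ℓ²(Λ) currency: [LF-II] (1.9) is an ℓ² coercivity), then it
dominates the sup-norm model of `lowCentre_certificate` with gradient residual `G·√#κ` and the SAME `γ`. [textbook] -/
theorem firstOrderModel_sup_of_l2 {K : Set (κ → ℝ)} {φ : (κ → ℝ) → ℝ} {m : κ → ℝ} {G γ : ℝ}
    (hG : 0 ≤ G) (hγ : 0 ≤ γ)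
    (h : ∀ v ∈ K, φ m - G * Real.sqrt (∑ b, (v b - m b) ^ 2) + γ / 2 * ∑ b, (v b - m b) ^ 2 ≤ φ v) :
    ∀ v ∈ K, φ m - G * Real.sqrt (Fintype.card κ : ℝ) * ‖v - m‖ + γ / 2 * ‖v - m‖ ^ 2 ≤ φ v := by
  intro v hv
  have h1 := h v hv
  have h2 : Real.sqrt (∑ b, (v b - m b) ^ 2) ≤ Real.sqrt (Fintype.card κ : ℝ) * ‖v - m‖ := by
    simpa only [Pi.sub_apply] using sqrt_sum_sq_le_sqrt_card_mul_pi_norm (v - m)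
  have h3 : ‖v - m‖ ^ 2 ≤ ∑ b, (v b - m b) ^ 2 := by
    simpa only [Pi.sub_apply] using sq_pi_norm_le_sum_sq (v - m)
  have h4 : G * Real.sqrt (∑ b, (v b - m b) ^ 2) ≤ G * Real.sqrt (Fintype.card κ : ℝ) * ‖v - m‖ := by
    rw [mul_assoc]; exact mul_le_mul_of_nonneg_left h2 hG
  have h5 : γ / 2 * ‖v - m‖ ^ 2 ≤ γ / 2 * ∑ b, (v b - m b) ^ 2 := mul_le_mul_of_nonneg_left h3 (by positivity)
  linarith

end NormTransfer

/-! ## §2  The certificate with a VALUE defect `W` (non-quadratic members bounded by value, not by gradient) -/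

section Defect

variable {V : Type*} [NormedAddCommGroup V]

/-- **DEFECTIVE FIRST-ORDER MODEL ⇒ LOW CENTRE.**  If `φ v ≥ φ m − G‖v − m‖ − W + (γ∕2)‖v − m‖²` on `K` (coercive
quadratic member `γ`, gradient-type residual `G`, VALUE-type residual `W ≥ 0` — print bounds the linear member (1.6) and
the cubic remainder of [LF-II] (1.2) by VALUE on the chart), then every `v ∈ K` with `‖v − m‖ ≥ 2G∕γ + √(2W∕γ)`
satisfies `φ m ≤ φ v`. [textbook] -/
theorem lowCentre_of_firstOrderModel_defect {K : Set V} {φ : V → ℝ} {m : V} {G W γ : ℝ} (hγ : 0 < γ) (hG : 0 ≤ G)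
    (hW : 0 ≤ W) (hmodel : ∀ v ∈ K, φ m - G * ‖v - m‖ - W + γ / 2 * ‖v - m‖ ^ 2 ≤ φ v) {v : V} (hv : v ∈ K)
    (hfar : 2 * G / γ + Real.sqrt (2 * W / γ) ≤ ‖v - m‖) : φ m ≤ φ v := by
  set r := ‖v - m‖ with hr
  set b := Real.sqrt (2 * W / γ) with hb
  have hb0 : 0 ≤ b := Real.sqrt_nonneg _
  have hb2 : b ^ 2 = 2 * W / γ := Real.sq_sqrt (by positivity)
  have ha0 : 0 ≤ 2 * G / γ := by positivity
  have hr0 : 0 ≤ r := norm_nonneg _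
  have hrb : b ≤ r := le_trans (le_add_of_nonneg_left ha0) hfar
  -- `(γ/2) r² ≥ (γ/2)(2G/γ + b) r = G r + (γ/2) b r ≥ G r + (γ/2) b² = G r + W`
  have h1 : γ / 2 * ((2 * G / γ + b) * r) ≤ γ / 2 * r ^ 2 := by
    have : (2 * G / γ + b) * r ≤ r * r := mul_le_mul_of_nonneg_right hfar hr0
    nlinarith
  have h2 : γ / 2 * ((2 * G / γ + b) * r) = G * r + γ / 2 * (b * r) := by
    field_simp
  have h3 : γ / 2 * (b * b) ≤ γ / 2 * (b * r) := by
    have : b * b ≤ b * r := mul_le_mul_of_nonneg_left hrb hb0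
    exact mul_le_mul_of_nonneg_left this (by positivity)
  have h4 : γ / 2 * (b * b) = W := by
    rw [← sq, hb2]
    field_simp
  linarith [hmodel v hv]

variable [NormedSpace ℝ V]

/-- **THE LOW-CENTRE CERTIFICATE WITH A VALUE DEFECT.**  As part 30's `lowCentre_certificate`, with the non-quadratic
members allowed a VALUE bound `W` besides the gradient bound `G`: the located numeral becomes
`2G∕γ + √(2W∕γ) ≤ l₀·(θ(1−ρ) − c₀)∕L`. [textbook] -/
theorem lowCentre_certificate_defect {K : Set V} (hK : Convex ℝ K) {φ U : V → ℝ} {m w : V}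
    {G W γ L c₀ θ ρ l₀ : ℝ} (hγ : 0 < γ) (hG : 0 ≤ G) (hW : 0 ≤ W) (hL : 0 < L) (hl₀ : 0 < l₀) (hl₀1 : l₀ ≤ 1)
    (hmodel : ∀ v ∈ K, φ m - G * ‖v - m‖ - W + γ / 2 * ‖v - m‖ ^ 2 ≤ φ v)
    (hU : ∀ a b : V, U a - U b ≤ L * ‖a - b‖) (hm : m ∈ K) (hw : w ∈ K)
    (hUm : U m ≤ c₀) (hUw : θ * (1 - ρ) ≤ U w)
    (hnum : 2 * G / γ + Real.sqrt (2 * W / γ) ≤ l₀ * ((θ * (1 - ρ) - c₀) / L)) :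
    φ m ≤ φ (m + l₀ • (w - m)) := by
  refine lowCentre_of_firstOrderModel_defect hγ hG hW hmodel (hK.add_smul_sub_mem hm hw ⟨hl₀.le, hl₀1⟩) ?_
  have hdist := N21LowCentreNonCollapse.norm_sub_ge_of_reading hL hU hUm hUw
  have hn : ‖m + l₀ • (w - m) - m‖ = l₀ * ‖w - m‖ := by
    rw [add_sub_cancel_left, norm_smul, Real.norm_of_nonneg hl₀.le]
  rw [hn]
  exact hnum.trans (mul_le_mul_of_nonneg_left hdist hl₀.le)

end Defect


/-! ## §3  Part 31's END with the lowness binder discharged by the DEFECT certificate -/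

section DefectEnd

open MeasureTheory Set
open scoped ENNReal
open Literature.MathematicalPhysics.QuantumFieldTheory.Balaban1983to89.T4ShellMeasure (SlotAntiConcentration)
open Summit.QuantumFields.YangMills.Theorems.N21LowCentreDilation (slotAntiConcentration_restrict_of_lowCentre)
open Summit.QuantumFields.YangMills.Theorems.N21LowCentreNumeral (recordContraction_pos recordContraction_le_one)

variable {X : Type*} [MeasurableSpace X] {κ : Type*} [Fintype κ]

/-- ★ **(M1) ON THE CUT LAW ABOUT A CERTIFIED LOW CENTRE, VALUE-DEFECT FORM.**  Part 31's
`slotAntiConcentration_restrict_of_lowCentre` with `hlow` DISCHARGED by `lowCentre_certificate_defect`: the block potential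
dominates `φ_z(m z) − G‖v − m z‖ − W + (γ∕2)‖v − m z‖²` on `K z` (print's currency: linear member and cubic remainder of
[LF-II] (1.2) bounded by VALUE — `W` —, quadratic member coercive — `γ`), the statistic is `L`-Lipschitz, the core reading
is `≤ c₀`, and the located numeral reads `2G∕γ + √(2W∕γ) ≤ (1 − 1∕(#κ+1))·(θ(1−ρ) − c₀)∕L`. [textbook] -/
theorem slotAntiConcentration_restrict_of_certifiedLowCentre_defect [Nonempty κ] (ζ : Measure X) [SFinite ζ]
    {m : X → (κ → ℝ)} (hm : Measurable m) (K : X → Set (κ → ℝ)) (φ : X → (κ → ℝ) → ℝ)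
    (hg : Measurable fun p : X × (κ → ℝ) =>
      (K p.1).indicator (fun w => ENNReal.ofReal (Real.exp (-φ p.1 w))) p.2)
    {U : X × (κ → ℝ) → ℝ} (hUm : Measurable U)
    {C Env : Set (X × (κ → ℝ))} (hC : MeasurableSet C) (hEnv : MeasurableSet Env)
    {θ ρ κ₀ Q G W γ L c₀ : ℝ} (hθ : 0 < θ) (hρ0 : 0 < ρ) (hρ1 : ρ < 1) (hκ : 0 < κ₀) (hQ0 : 0 ≤ Q)
    (hγ : 0 < γ) (hG : 0 ≤ G) (hW : 0 ≤ W) (hL : 0 < L)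
    (hK : ∀ z, Convex ℝ (K z)) (hφ : ∀ z, ConvexOn ℝ (K z) (φ z)) (hmK : ∀ z, m z ∈ K z)
    (hmodel : ∀ z, ∀ v ∈ K z, φ z (m z) - G * ‖v - m z‖ - W + γ / 2 * ‖v - m z‖ ^ 2 ≤ φ z v)
    (hU : ∀ z (a b : κ → ℝ), U (z, a) - U (z, b) ≤ L * ‖a - b‖)
    (hUc : ∀ z, U (z, m z) ≤ c₀)
    (hnum : 2 * G / γ + Real.sqrt (2 * W / γ) ≤ (1 - 1 / ((Fintype.card κ : ℝ) + 1)) * ((θ * (1 - ρ) - c₀) / L))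
    (henv : ∀ l ∈ Icc (1 - 1 / ((Fintype.card κ : ℝ) + 1)) 1, ∀ p : X × (κ → ℝ),
      θ * (1 - ρ) ≤ U p → U p < θ → p ∈ C → (p.1, m p.1 + l • (p.2 - m p.1)) ∈ Env)
    (hRT : ∀ p : X × (κ → ℝ), θ * (1 - ρ) ≤ U p → U p < θ → p ∈ C → ∀ s : ℝ, 1 ≤ s →
      θ * (1 - ρ) ≤ U (p.1, m p.1 + s • (p.2 - m p.1)) → U (p.1, m p.1 + s • (p.2 - m p.1)) < θ →
        (p.1, m p.1 + s • (p.2 - m p.1)) ∈ C →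
          U p + κ₀ * (θ * (1 - ρ)) * (s - 1) ≤ U (p.1, m p.1 + s • (p.2 - m p.1)))
    (hQ : ((ζ.prod volume).withDensity fun p : X × (κ → ℝ) =>
        (K p.1).indicator (fun w => ENNReal.ofReal (Real.exp (-φ p.1 w))) p.2) (Env \ ({p | U p < θ} ∩ C))
      ≤ ENNReal.ofReal Q * ((ζ.prod volume).withDensity fun p : X × (κ → ℝ) =>
        (K p.1).indicator (fun w => ENNReal.ofReal (Real.exp (-φ p.1 w))) p.2) ({p | U p < θ} ∩ C)) :
    SlotAntiConcentration
      ((((ζ.prod volume).withDensity fun p : X × (κ → ℝ) =>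
          (K p.1).indicator (fun w => ENNReal.ofReal (Real.exp (-φ p.1 w))) p.2)).restrict ({p | U p < θ} ∩ C))
      U θ ρ (3 * ((Fintype.card κ : ℝ) + 1) * (1 + Q) / (κ₀ * (1 - ρ))) := by
  refine slotAntiConcentration_restrict_of_lowCentre ζ hm K φ hg hUm hC hEnv hθ hρ0 hρ1 hκ hQ0 hK hφ hmK
    ?_ henv hRT hQ
  intro p h1 _ _ hw
  exact lowCentre_certificate_defect (hK p.1) (U := fun w => U (p.1, w)) hγ hG hW hL (recordContraction_pos κ)
    (recordContraction_le_one κ) (hmodel p.1) (fun a b => hU p.1 a b) (hmK p.1) hw (hUc p.1) h1 hnum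

end DefectEnd

/-! ## §4  A6 witness of the defect END: every binder discharged, a genuine value defect `W > 0` -/

section Witness

open MeasureTheory Set
open scoped ENNReal
open Literature.MathematicalPhysics.QuantumFieldTheory.Balaban1983to89.T4ShellMeasure (SlotAntiConcentration)
open Summit.QuantumFields.YangMills.Theorems.N21LowCentreNumeral (convexOn_tiltedQuadratic_one)

/-- **A6 WITNESS OF THE ★ DEFECT END** (director-ym STANDING A6 RULE №189 (3)): every binder of
`slotAntiConcentration_restrict_of_certifiedLowCentre_defect` discharged in the kernel — exterior `X = Unit` under
`dirac ()`, block `ℝ¹`, `K = univ`, potential `φ(w) = w₀²∕2 − w₀∕24` (p583903's tilted quadratic; minimiser `1∕24 ≠`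
centre `0`), first-order model with NO gradient term (`G = 0`) and a genuine VALUE defect `W = 1∕576`, `γ = ½`
(`w₀²∕2 − w₀∕24 ≥ −1∕576 + w₀²∕4` since `w₀²∕4 − w₀∕24 + 1∕576 = (w₀∕2 − 1∕24)²`), statistic `U = |w₀|` (`L = 1`,
`κ₀ = 1`), `c₀ = 0`, `θ = 1`, `ρ = ½`, `C = univ`, `Env = {U < 1}`, `Q = 0`; the numeral:
`0 + √(2W∕γ) = 1∕12 ≤ ¼ = ½·(½ − 0)∕1`.  A satisfiability witness, not an estimate on Bałaban's measure. [textbook] -/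
theorem certifiedLowCentreDefect_binders_inhabited :
    SlotAntiConcentration
      ((((Measure.dirac ()).prod (volume : Measure (Fin 1 → ℝ))).withDensity
          fun p : Unit × (Fin 1 → ℝ) =>
            (univ : Set (Fin 1 → ℝ)).indicator
              (fun w => ENNReal.ofReal (Real.exp (-(w 0 ^ 2 / 2 - w 0 / 24)))) p.2).restrict
        ({p : Unit × (Fin 1 → ℝ) | |p.2 0| < 1} ∩ univ))
      (fun p : Unit × (Fin 1 → ℝ) => |p.2 0|) 1 (1 / 2)
      (3 * ((Fintype.card (Fin 1) : ℝ) + 1) * (1 + 0) / (1 * (1 - 1 / 2))) := by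
  have hU : Measurable fun p : Unit × (Fin 1 → ℝ) => |p.2 0| := ((measurable_pi_apply 0).comp measurable_snd).abs
  have hφm : Measurable fun w : Fin 1 → ℝ => w 0 ^ 2 / 2 - w 0 / 24 :=
    (((measurable_pi_apply 0).pow_const 2).div_const 2).sub ((measurable_pi_apply 0).div_const 24)
  have hg : Measurable fun p : Unit × (Fin 1 → ℝ) =>
      (univ : Set (Fin 1 → ℝ)).indicator (fun w => ENNReal.ofReal (Real.exp (-(w 0 ^ 2 / 2 - w 0 / 24)))) p.2 := by
    simp only [indicator_univ]
    exact (ENNReal.measurable_ofReal.comp (Real.measurable_exp.comp hφm.neg)).comp measurable_snd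
  have hEnv : MeasurableSet {p : Unit × (Fin 1 → ℝ) | |p.2 0| < 1} := measurableSet_lt hU measurable_const
  have hcard : (Fintype.card (Fin 1) : ℝ) = 1 := by simp
  refine slotAntiConcentration_restrict_of_certifiedLowCentre_defect (Measure.dirac ()) (m := fun _ => 0)
    measurable_const (fun _ => univ) (fun _ w => w 0 ^ 2 / 2 - w 0 / 24) hg hU MeasurableSet.univ hEnv
    (Env := {p : Unit × (Fin 1 → ℝ) | |p.2 0| < 1}) (κ₀ := 1) (Q := 0) (G := 0) (W := 1 / 576) (γ := 1 / 2)
    (L := 1) (c₀ := 0) one_pos (by norm_num) (by norm_num) one_pos le_rfl (by norm_num) le_rfl (by norm_num) one_pos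
    (fun _ => convex_univ) (fun _ => convexOn_tiltedQuadratic_one) (fun _ => mem_univ _) ?_ ?_ ?_ ?_ ?_ ?_ ?_
  · -- hmodel: defect model about 0 with G = 0, W = 1/576, γ = 1/2 (sup norm of ℝ¹ is `|v 0|`)
    intro _ v _
    have hnorm : ‖v‖ = |v 0| := by
      refine le_antisymm ((pi_norm_le_iff_of_nonneg (abs_nonneg _)).2 fun i => ?_) ?_
      · rw [Subsingleton.elim i 0, Real.norm_eq_abs]
      · simpa only [Real.norm_eq_abs] using norm_le_pi_norm v 0
    simp only [Pi.zero_apply, sub_zero, hnorm, sq_abs, zero_mul]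
    nlinarith [sq_nonneg (v 0 / 2 - 1 / 24)]
  · -- hU: the coordinate statistic is 1-Lipschitz for the sup norm
    intro _ a b
    have h := norm_le_pi_norm (a - b) 0
    rw [Pi.sub_apply, Real.norm_eq_abs] at h
    have h2 := abs_abs_sub_abs_le_abs_sub (a 0) (b 0)
    rw [one_mul]
    exact (le_abs_self _).trans (h2.trans h)
  · -- hUc
    intro _
    simp
  · -- hnum: `0 + √(2·(1/576)/(1/2)) = 1/12 ≤ (1 − ½)·((1·½ − 0)/1) = ¼`
    rw [hcard]
    have hs : Real.sqrt (2 * (1 / 576) / (1 / 2)) = 1 / 12 := by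
      rw [show (2 * (1 / 576) / (1 / 2) : ℝ) = (1 / 12) ^ 2 by norm_num]
      exact Real.sqrt_sq (by norm_num)
    rw [hs]
    norm_num
  · -- henv
    intro l hl p _ h2 _
    rw [hcard] at hl
    have hl0 : 0 ≤ l := by have := hl.1; norm_num at this; linarith
    show |((0 : Fin 1 → ℝ) + l • (p.2 - 0)) 0| < 1
    simp only [zero_add, sub_zero, Pi.smul_apply, smul_eq_mul, abs_mul, abs_of_nonneg hl0]
    have h2' : |p.2 0| < 1 := h2
    nlinarith [abs_nonneg (p.2 0), hl.2]
  · -- hRT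
    intro p h1 _ _ r hr _ _ _
    have h1' : 1 / 2 ≤ |p.2 0| := by have h := h1; norm_num at h; exact h
    show |p.2 0| + 1 * (1 * (1 - 1 / 2)) * (r - 1) ≤ |((0 : Fin 1 → ℝ) + r • (p.2 - 0)) 0|
    simp only [zero_add, sub_zero, Pi.smul_apply, smul_eq_mul]
    rw [abs_mul, abs_of_nonneg (by linarith : (0 : ℝ) ≤ r)]
    nlinarith [mul_nonneg (show (0 : ℝ) ≤ r - 1 by linarith) (show (0 : ℝ) ≤ |p.2 0| - 1 / 2 by linarith)]
  · -- hQ: `Env \ ({U < 1} ∩ univ) = ∅`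
    have hempty : {p : Unit × (Fin 1 → ℝ) | |p.2 0| < 1} \ ({p : Unit × (Fin 1 → ℝ) | |p.2 0| < 1} ∩ univ) = ∅ := by
      ext p
      simp
    rw [hempty, measure_empty]
    exact zero_le

end Witness


/-! ## §5  At [LF-II] §1's letters BY NAME: (1.2) expansion · (1.6) linear member · (1.9) coercivity -/

section Sect1Letters

open Literature.MathematicalPhysics.QuantumFieldTheory.Balaban1983to89.B16Sect1Wilson (Ineq16 Ineq19)

variable {κ : Type*} [Fintype κ]

/-- ★★ **THE DEFECT MODEL ABOUT THE BACKGROUND AT [LF-II] §1's LETTERS, BY NAME** ([Balaban1989LargeFieldII] pp.356–358,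
desk ME #33∕#34 AS PRINTED).  In the block chart `B′ = v ∈ K ⊆ (κ → ℝ)` (bonds of `Λ` off the axial tree `G₀`;
`K ⊆ {|B′| < M₀g_k⁻¹ε_k}`) write the exponent of (1.2) as `φ v = φ 0 + ½·Q v + lin v + Vt v` (quadratic member
`½⟨H_{1,k}B′, Δ₁(ζ₀)H_{1,k}B′⟩` WITH the `½`, linear member `−(1∕g_k)⟨DH_{1,k}B′, ζ₀η⁻²Im ∂U₀⟩`, cubic remainder
`−(1∕g_k²)V(ζ₀, g_kH_{1,k}B′)`).  If the quadratic member is coercive in print's ℓ²(Λ) currency as in (1.9)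
(`Ineq19 (Q v) (Σ_b v_b²) γ₀ d M`, i.e. `γ₀∕(2d(100M)^{d+1})·‖B′‖₂² ≤ Q v`, «for g_k sufficiently small»), the linear
member's VALUE obeys (1.6) (`Ineq16 (lin v) B₃ M₀ A₀ p₀(g_k) R_k M`, «e.g., the number 1») and the remainder's VALUE is
`≤ W_V` («It can be estimated by O(g_k^{1−β})|Λ|», p.357, prose), then the sup-norm DEFECT model of §2 holds about the
centre `0` (the background `U₀`) with NO gradient term, `W = 3B₃M₀A₀²p₀(g_k)²e^{−R_k}(100M)⁴ + W_V` and
`γ = γ₀∕(2d(100M)^{d+1})`.  Located letters are hypotheses; the identification is this seat's typing, not print's.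
[textbook] -/
theorem firstOrderModel_of_sect1Letters {K : Set (κ → ℝ)} {φ Q lin Vt : (κ → ℝ) → ℝ}
    {γ₀ M B₃ M₀ A₀ p₀g Rk WV : ℝ} {d : ℕ} (hd : 1 ≤ d) (hM : 0 < M) (hγ₀ : 0 ≤ γ₀)
    (hexp : ∀ v ∈ K, φ v = φ 0 + 1 / 2 * Q v + lin v + Vt v)
    (h19 : ∀ v ∈ K, Ineq19 (Q v) (∑ b, v b ^ 2) γ₀ d M)
    (h16 : ∀ v ∈ K, Ineq16 (lin v) B₃ M₀ A₀ p₀g Rk M) (hV : ∀ v ∈ K, |Vt v| ≤ WV) :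
    ∀ v ∈ K, φ 0 - 0 * ‖v - 0‖ - (3 * B₃ * M₀ * A₀ ^ 2 * p₀g ^ 2 * Real.exp (-Rk) * (100 * M) ^ 4 + WV)
      + γ₀ / (2 * d * (100 * M) ^ (d + 1)) / 2 * ‖v - 0‖ ^ 2 ≤ φ v := by
  intro v hv
  have hq := h19 v hv
  have hl := h16 v hv
  unfold Ineq19 at hq
  unfold Ineq16 at hl
  have hd0 : (0 : ℝ) < d := by exact_mod_cast hd
  have hc : 0 ≤ γ₀ / (2 * d * (100 * M) ^ (d + 1)) := by positivity
  have hn : ‖v - 0‖ ^ 2 ≤ ∑ b, v b ^ 2 := by simpa only [sub_zero] using sq_pi_norm_le_sum_sq v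
  have h1 : γ₀ / (2 * d * (100 * M) ^ (d + 1)) / 2 * ‖v - 0‖ ^ 2 ≤ 1 / 2 * Q v := by
    have := mul_le_mul_of_nonneg_left hn hc
    linarith
  have h2 : -(3 * B₃ * M₀ * A₀ ^ 2 * p₀g ^ 2 * Real.exp (-Rk) * (100 * M) ^ 4) ≤ lin v := by
    have := (abs_lt.1 hl).1
    linarith
  have h3 : -WV ≤ Vt v := (abs_le.1 (hV v hv)).1
  rw [hexp v hv]
  linarith

/-- ★★★ **THE LOCATED NUMERAL AT [LF-II] §1's LETTERS.**  With NO gradient term and the value defect `W`, coercivity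
`γ = γ₀∕(2d(100M)^{d+1})` ((1.9)), a core reading RELATIVE to the letter (`c₀ ≤ σθ`, `ρ + σ ≤ 1`; lens N210), modulus
`L`, contraction `l₀ ≥ ½`: the defect numeral `2·0∕γ + √(2W∕γ) ≤ l₀(θ(1−ρ) − c₀)∕L` of §2∕§3 FOLLOWS FROM the ONE clause
`16·W·d·(100M)^{d+1}·L² ≤ γ₀·(θ(1−ρ−σ))²` — print's «for g_k sufficiently small»: in the `1∕g_k`-rescaled chart the
letter `θ∕L` grows like `A₀p₀(g_k) = (ε_k∕g_k)`-units while `W ≤ 1 + O(g_k^{1−β})(100M)⁴` stays bounded ((1.6) «e.g.,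
the number 1»).  LOCATED, nothing of Bałaban's asserted. [textbook] -/
theorem numeral_at_sect1Letters {W γ₀ M θ ρ σ c₀ L l₀ : ℝ} {d : ℕ} (hd : 1 ≤ d) (hM : 0 < M) (hγ₀ : 0 < γ₀)
    (hθ : 0 ≤ θ) (hL : 0 < L) (hl₀ : 1 / 2 ≤ l₀) (hρσ : ρ + σ ≤ 1) (hc₀ : c₀ ≤ σ * θ)
    (hclause : 16 * W * d * (100 * M) ^ (d + 1) * L ^ 2 ≤ γ₀ * (θ * (1 - ρ - σ)) ^ 2) :
    2 * 0 / (γ₀ / (2 * d * (100 * M) ^ (d + 1))) + Real.sqrt (2 * W / (γ₀ / (2 * d * (100 * M) ^ (d + 1))))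
      ≤ l₀ * ((θ * (1 - ρ) - c₀) / L) := by
  have hd0 : (0 : ℝ) < d := by exact_mod_cast hd
  set P : ℝ := (100 * M) ^ (d + 1) with hP
  have hP0 : 0 < P := by positivity
  set Xr : ℝ := θ * (1 - ρ - σ) with hX
  have hX0 : 0 ≤ Xr := mul_nonneg hθ (by linarith)
  have hXY : Xr ≤ θ * (1 - ρ) - c₀ := by rw [hX]; nlinarith
  -- the square of the target bound dominates `2W/γ`
  have hsq : 2 * W / (γ₀ / (2 * d * P)) ≤ (Xr / (2 * L)) ^ 2 := by
    have e1 : 2 * W / (γ₀ / (2 * d * P)) = 4 * W * d * P / γ₀ := by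
      rw [div_div_eq_mul_div]
      ring
    have e2 : (Xr / (2 * L)) ^ 2 = Xr ^ 2 / (4 * L ^ 2) := by
      rw [div_pow]
      ring
    rw [e1, e2, div_le_div_iff₀ hγ₀ (by positivity)]
    nlinarith [hclause]
  have hroot : Real.sqrt (2 * W / (γ₀ / (2 * d * P))) ≤ Xr / (2 * L) :=
    calc Real.sqrt (2 * W / (γ₀ / (2 * d * P))) ≤ Real.sqrt ((Xr / (2 * L)) ^ 2) := Real.sqrt_le_sqrt hsq
      _ = Xr / (2 * L) := Real.sqrt_sq (by positivity)
  have hY0 : 0 ≤ (θ * (1 - ρ) - c₀) / L := div_nonneg (hX0.trans hXY) hL.le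
  have h2 : Xr / (2 * L) ≤ l₀ * ((θ * (1 - ρ) - c₀) / L) :=
    calc Xr / (2 * L) = 1 / 2 * (Xr / L) := by field_simp
      _ ≤ 1 / 2 * ((θ * (1 - ρ) - c₀) / L) :=
          mul_le_mul_of_nonneg_left (div_le_div_of_nonneg_right hXY hL.le) (by norm_num)
      _ ≤ l₀ * ((θ * (1 - ρ) - c₀) / L) := mul_le_mul_of_nonneg_right hl₀ hY0
  have h0 : 2 * (0 : ℝ) / (γ₀ / (2 * d * P)) = 0 := by simp
  rw [h0, zero_add]
  exact hroot.trans h2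

end Sect1Letters

end Summit.QuantumFields.YangMills.Theorems.N21LowCentreNumeralBlock
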